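import Literature.Analysis.PDE.SobolevHighLow
import Literature.Analysis.PDE.AffineWordBounds
import Literature.Analysis.PDE.SobolevLinearTransport
import HarnessLib

/-!
# Sobolev energies and iterated Fréchet derivatives (topic `Analysis/PDE`)

Layer (III), step 5b (bridge), of the programme to prove short-time existence for quasilinear
strictly parabolic systems on a closed manifold (hypothesis `hQL` of
`Literature.Geometry.Riemannian.ricciFlow_shortTime_existence_of_quasilinear`). The composition
estimates (`JetComposition.lean`) are phrased with iterated Fréchet derivatives, the linear
theory with the frame energies `sobolevEnergy`; this file converts between the two currencies:

* `lintegral_iteratedFDeriv_sq_le` — `∫ ‖Dᵐ f‖² ≤ n^{2m} E_m(f)`;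
* `sobolevEnergy_le_sum_lintegral_iteratedFDeriv` — `E_K(f) ≤ Σ_{m ≤ K} nᵐ ∫ ‖Dᵐ f‖²`;
* `sobolevEnergy_le_of_pointwise` — energies of a field whose iterated derivatives are
  pointwise dominated: if `‖Dⁱ F(y)‖ ≤ C Σ_{m ≤ i} ‖Dᵐ g(y)‖` for `i ≤ K` then
  `E_K(F) ≤ C' C² Σ_{m ≤ K} E_m(g)`.

Everything is proved; no named fact and no `sorry` is introduced.

## References

* R. A. Adams, *Sobolev Spaces*, Academic Press 1975, §1.
  [Adams1975]
-/

noncomputable section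

open MeasureTheory Set Function Filter
open scoped ENNReal ContDiff

namespace Literature.Analysis.PDE

open Literature.Analysis.FunctionSpaces

variable {E : Type*} [NormedAddCommGroup E] [InnerProductSpace ℝ E] [FiniteDimensional ℝ E]
  [MeasurableSpace E] [BorelSpace E]
variable {F : Type*} [NormedAddCommGroup F] [NormedSpace ℝ F]

/-! ### From energies to iterated derivatives -/

omit [MeasurableSpace E] [BorelSpace E] in
/-- **Energies through iterated derivatives, upper bound on single orders**: for smooth `f`,
`Σ_{|w| = m} ∫ ‖∂_w f‖² ≤ E_m(f)`-type bounds give `∫ ‖Dᵐf‖² ≤ n^{2m} E_m(f)`; we prove the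
pointwise version `‖Dᵐ f(y)‖² ≤ n^{2m} Σ_{|w|=m} ‖∂_w f(y)‖²` integrated. [cite: Adams1975, §1] -/
theorem sq_norm_iteratedFDeriv_le {f : E → F} (hf : ContDiff ℝ ∞ f) (m : ℕ) (y : E) :
    ‖iteratedFDeriv ℝ m f y‖ ^ 2 ≤ ((Module.finrank ℝ E : ℝ) ^ m) ^ 2 *
      ∑ v : Fin m → Fin (Module.finrank ℝ E), ‖iterDirDeriv (List.ofFn fun k ↦ stdOrthonormalBasis ℝ E (v k)) f y‖ ^ 2 := by
  classical
  set S := ∑ v : Fin m → Fin (Module.finrank ℝ E), ‖iterDirDeriv (List.ofFn fun k ↦ stdOrthonormalBasis ℝ E (v k)) f y‖ ^ 2 with hS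
  have hS0 : 0 ≤ S := Finset.sum_nonneg fun v _ ↦ sq_nonneg _
  -- every word is bounded by `√S`
  have hw : ∀ v : Fin m → Fin (Module.finrank ℝ E), ‖iterDirDeriv (List.ofFn fun k ↦ stdOrthonormalBasis ℝ E (v k)) f y‖ ≤ Real.sqrt S := by
    intro v
    refine Real.le_sqrt_of_sq_le ?_
    exact Finset.single_le_sum (f := fun v ↦ ‖iterDirDeriv (List.ofFn fun k ↦ stdOrthonormalBasis ℝ E (v k)) f y‖ ^ 2) (fun _ _ ↦ sq_nonneg _)
      (Finset.mem_univ v)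
  have h := norm_iteratedFDeriv_le_of_frame_words hf m y (Real.sqrt_nonneg S) hw
  calc ‖iteratedFDeriv ℝ m f y‖ ^ 2 ≤ ((Module.finrank ℝ E : ℝ) ^ m * Real.sqrt S) ^ 2 := pow_le_pow_left₀ (norm_nonneg _) h 2
    _ = ((Module.finrank ℝ E : ℝ) ^ m) ^ 2 * S := by rw [mul_pow, Real.sq_sqrt hS0]

/-- **`∫ ‖Dᵐ f‖² ≤ n^{2m} E_m(f)`** for smooth `f`. [cite: Adams1975, §1] -/
theorem lintegral_iteratedFDeriv_sq_le {f : E → F} (hf : ContDiff ℝ ∞ f) (m : ℕ) :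
    (∫⁻ y, ‖iteratedFDeriv ℝ m f y‖ₑ ^ 2) ≤ ENNReal.ofReal (((Module.finrank ℝ E : ℝ) ^ m) ^ 2) * sobolevEnergy m f := by
  classical
  set n := Module.finrank ℝ E with hn
  -- pointwise
  have hpt : ∀ y, ‖iteratedFDeriv ℝ m f y‖ₑ ^ 2 ≤ ENNReal.ofReal (((n : ℝ) ^ m) ^ 2) *
      ∑ v : Fin m → Fin n, ‖iterDirDeriv (List.ofFn fun k ↦ stdOrthonormalBasis ℝ E (v k)) f y‖ₑ ^ 2 := by
    intro y
    have h := sq_norm_iteratedFDeriv_le hf m y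
    have hlhs : ‖iteratedFDeriv ℝ m f y‖ₑ ^ 2 = ENNReal.ofReal (‖iteratedFDeriv ℝ m f y‖ ^ 2) := by
      rw [← ofReal_norm, ENNReal.ofReal_pow (norm_nonneg _)]
    have hrhs : ∑ v : Fin m → Fin n, ‖iterDirDeriv (List.ofFn fun k ↦ stdOrthonormalBasis ℝ E (v k)) f y‖ₑ ^ 2 =
        ENNReal.ofReal (∑ v : Fin m → Fin n, ‖iterDirDeriv (List.ofFn fun k ↦ stdOrthonormalBasis ℝ E (v k)) f y‖ ^ 2) := by
      rw [ENNReal.ofReal_sum_of_nonneg fun v _ ↦ sq_nonneg _]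
      refine Finset.sum_congr rfl fun v _ ↦ ?_
      rw [← ofReal_norm, ENNReal.ofReal_pow (norm_nonneg _)]
    rw [hlhs, hrhs, ← ENNReal.ofReal_mul (sq_nonneg _)]
    exact ENNReal.ofReal_le_ofReal h
  calc (∫⁻ y, ‖iteratedFDeriv ℝ m f y‖ₑ ^ 2)
      ≤ ∫⁻ y, ENNReal.ofReal (((n : ℝ) ^ m) ^ 2) * ∑ v : Fin m → Fin n, ‖iterDirDeriv (List.ofFn fun k ↦ stdOrthonormalBasis ℝ E (v k)) f y‖ₑ ^ 2 :=
        lintegral_mono hpt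
    _ = ENNReal.ofReal (((n : ℝ) ^ m) ^ 2) * ∑ v : Fin m → Fin n, ∫⁻ y, ‖iterDirDeriv (List.ofFn fun k ↦ stdOrthonormalBasis ℝ E (v k)) f y‖ₑ ^ 2 := by
        rw [lintegral_const_mul' _ _ ENNReal.ofReal_ne_top, lintegral_finsetSum' _ fun v _ ↦ ?_]
        exact ((continuous_enorm.comp (contDiff_iterDirDeriv hf _).continuous).measurable.pow_const 2).aemeasurable
    _ ≤ ENNReal.ofReal (((n : ℝ) ^ m) ^ 2) * sobolevEnergy m f := by
        refine mul_le_mul' le_rfl ?_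
        rw [sobolevEnergy_eq_sum_words]
        exact Finset.single_le_sum (f := fun i ↦ ∑ β : Fin i → Fin n, ∫⁻ x, ‖iterDirDeriv (List.ofFn fun l ↦ stdOrthonormalBasis ℝ E (β l)) f x‖ₑ ^ 2)
          (fun _ _ ↦ bot_le) (Finset.mem_range.2 (Nat.lt_succ_self m))

/-- **`E_K(f) ≤ Σ_{m ≤ K} nᵐ ∫ ‖Dᵐ f‖²`** for smooth `f`. [cite: Adams1975, §1] -/
theorem sobolevEnergy_le_sum_lintegral_iteratedFDeriv {f : E → F} (hf : ContDiff ℝ ∞ f) (K : ℕ) :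
    sobolevEnergy K f ≤ ∑ m ∈ Finset.range (K + 1), ((Module.finrank ℝ E : ℝ≥0∞) ^ m) * ∫⁻ y, ‖iteratedFDeriv ℝ m f y‖ₑ ^ 2 := by
  classical
  set n := Module.finrank ℝ E with hn
  rw [sobolevEnergy_eq_sum_words]
  refine Finset.sum_le_sum fun m _ ↦ ?_
  have hword : ∀ (β : Fin m → Fin n) (y : E), ‖iterDirDeriv (List.ofFn fun l ↦ stdOrthonormalBasis ℝ E (β l)) f y‖ₑ ^ 2 ≤ ‖iteratedFDeriv ℝ m f y‖ₑ ^ 2 := by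
    intro β y
    have h := norm_iterDirDeriv_le hf (List.ofFn fun l ↦ stdOrthonormalBasis ℝ E (β l)) y
    have hprod : ∏ i, ‖(List.ofFn fun l ↦ stdOrthonormalBasis ℝ E (β l)).get i‖ = 1 :=
      Finset.prod_eq_one fun i _ ↦ by simp [(stdOrthonormalBasis ℝ E).orthonormal.1]
    rw [hprod, mul_one, List.length_ofFn] at h
    rw [← ofReal_norm, ← ofReal_norm, ← ENNReal.ofReal_pow (norm_nonneg _), ← ENNReal.ofReal_pow (norm_nonneg _)]
    exact ENNReal.ofReal_le_ofReal (pow_le_pow_left₀ (norm_nonneg _) h 2)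
  calc ∑ β : Fin m → Fin n, ∫⁻ y, ‖iterDirDeriv (List.ofFn fun l ↦ stdOrthonormalBasis ℝ E (β l)) f y‖ₑ ^ 2
      ≤ ∑ _β : Fin m → Fin n, ∫⁻ y, ‖iteratedFDeriv ℝ m f y‖ₑ ^ 2 := Finset.sum_le_sum fun β _ ↦ lintegral_mono fun y ↦ hword β y
    _ = ((n : ℝ≥0∞) ^ m) * ∫⁻ y, ‖iteratedFDeriv ℝ m f y‖ₑ ^ 2 := by
        rw [Finset.sum_const, Finset.card_univ, Fintype.card_fun, Fintype.card_fin, Fintype.card_fin, nsmul_eq_mul]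
        push_cast; ring

/-- **Energies from pointwise domination of iterated derivatives**: if for all `i ≤ K` and all
`y`, `‖Dⁱ F(y)‖ ≤ C Σ_{m ≤ i} ‖Dᵐ g(y)‖` (smooth `F, g`), then
`E_K(F) ≤ C' · C² · Σ_{m ≤ K} E_m(g)` with `C'` depending on `K` and `dim E` only.
[cite: Adams1975, §1] -/
theorem sobolevEnergy_le_of_pointwise (K : ℕ) :
    ∃ C' : ℝ≥0∞, C' ≠ ⊤ ∧ ∀ {Φ g : E → F}, ContDiff ℝ ∞ Φ → ContDiff ℝ ∞ g → ∀ {C : ℝ}, 0 ≤ C →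
      (∀ i ≤ K, ∀ y, ‖iteratedFDeriv ℝ i Φ y‖ ≤ C * ∑ m ∈ Finset.range (i + 1), ‖iteratedFDeriv ℝ m g y‖) →
      sobolevEnergy K Φ ≤ C' * ENNReal.ofReal (C ^ 2) * ∑ m ∈ Finset.range (K + 1), sobolevEnergy m g := by
  classical
  set n := Module.finrank ℝ E with hn
  set A : ℝ≥0∞ := ∑ m ∈ Finset.range (K + 1), ((n : ℝ≥0∞) ^ m) * ((K + 1 : ℕ) : ℝ≥0∞) * ENNReal.ofReal (((n : ℝ) ^ K) ^ 2 + 1) with hA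
  refine ⟨A, ?_, ?_⟩
  · exact ENNReal.sum_ne_top.2 fun m _ ↦ ENNReal.mul_ne_top (ENNReal.mul_ne_top (ENNReal.pow_ne_top (ENNReal.natCast_ne_top _)) (ENNReal.natCast_ne_top _))
      ENNReal.ofReal_ne_top
  intro Φ g hF hg C hC0 hdom
  set T := ∑ m ∈ Finset.range (K + 1), sobolevEnergy m g with hT
  -- `∫ ‖Dⁱ Φ‖² ≤ C² (i+1) Σ_{m≤i} ∫ ‖Dᵐ g‖² ≤ C² (K+1) (n^{2K}+1) T`
  have hint : ∀ i ≤ K, (∫⁻ y, ‖iteratedFDeriv ℝ i Φ y‖ₑ ^ 2) ≤ ENNReal.ofReal (C ^ 2) * (((K + 1 : ℕ) : ℝ≥0∞) * ENNReal.ofReal (((n : ℝ) ^ K) ^ 2 + 1) * T) := by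
    intro i hi
    have hpt : ∀ y, ‖iteratedFDeriv ℝ i Φ y‖ₑ ^ 2 ≤ ENNReal.ofReal (C ^ 2) * (((i + 1 : ℕ) : ℝ≥0∞) *
        ∑ m ∈ Finset.range (i + 1), ‖iteratedFDeriv ℝ m g y‖ₑ ^ 2) := by
      intro y
      have h := hdom i hi y
      -- Cauchy–Schwarz: `(Σ_{m≤i} a_m)² ≤ (i+1) Σ a_m²`
      have hcs : (∑ m ∈ Finset.range (i + 1), ‖iteratedFDeriv ℝ m g y‖) ^ 2 ≤ ((i + 1 : ℕ) : ℝ) * ∑ m ∈ Finset.range (i + 1), ‖iteratedFDeriv ℝ m g y‖ ^ 2 := by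
        have h1 := sq_sum_le_card_mul_sum_sq (s := Finset.range (i + 1)) (f := fun m ↦ ‖iteratedFDeriv ℝ m g y‖)
        simpa [Finset.card_range] using h1
      have hsq : ‖iteratedFDeriv ℝ i Φ y‖ ^ 2 ≤ C ^ 2 * (((i + 1 : ℕ) : ℝ) * ∑ m ∈ Finset.range (i + 1), ‖iteratedFDeriv ℝ m g y‖ ^ 2) := by
        calc ‖iteratedFDeriv ℝ i Φ y‖ ^ 2 ≤ (C * ∑ m ∈ Finset.range (i + 1), ‖iteratedFDeriv ℝ m g y‖) ^ 2 := pow_le_pow_left₀ (norm_nonneg _) h 2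
          _ = C ^ 2 * (∑ m ∈ Finset.range (i + 1), ‖iteratedFDeriv ℝ m g y‖) ^ 2 := by ring
          _ ≤ _ := mul_le_mul_of_nonneg_left hcs (sq_nonneg _)
      have hl : ‖iteratedFDeriv ℝ i Φ y‖ₑ ^ 2 = ENNReal.ofReal (‖iteratedFDeriv ℝ i Φ y‖ ^ 2) := by rw [← ofReal_norm, ENNReal.ofReal_pow (norm_nonneg _)]
      have hr : ∑ m ∈ Finset.range (i + 1), ‖iteratedFDeriv ℝ m g y‖ₑ ^ 2 = ENNReal.ofReal (∑ m ∈ Finset.range (i + 1), ‖iteratedFDeriv ℝ m g y‖ ^ 2) := by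
        rw [ENNReal.ofReal_sum_of_nonneg fun m _ ↦ sq_nonneg _]
        refine Finset.sum_congr rfl fun m _ ↦ ?_
        rw [← ofReal_norm, ENNReal.ofReal_pow (norm_nonneg _)]
      rw [hl, hr, ← ENNReal.ofReal_natCast, ← ENNReal.ofReal_mul (Nat.cast_nonneg _), ← ENNReal.ofReal_mul (sq_nonneg _)]
      exact ENNReal.ofReal_le_ofReal hsq
    calc (∫⁻ y, ‖iteratedFDeriv ℝ i Φ y‖ₑ ^ 2)
        ≤ ∫⁻ y, ENNReal.ofReal (C ^ 2) * (((i + 1 : ℕ) : ℝ≥0∞) * ∑ m ∈ Finset.range (i + 1), ‖iteratedFDeriv ℝ m g y‖ₑ ^ 2) := lintegral_mono hpt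
      _ = ENNReal.ofReal (C ^ 2) * (((i + 1 : ℕ) : ℝ≥0∞) * ∑ m ∈ Finset.range (i + 1), ∫⁻ y, ‖iteratedFDeriv ℝ m g y‖ₑ ^ 2) := by
          rw [lintegral_const_mul' _ _ ENNReal.ofReal_ne_top, lintegral_const_mul' _ _ (ENNReal.natCast_ne_top _), lintegral_finsetSum' _ fun m _ ↦ ?_]
          exact ((continuous_enorm.comp (hg.continuous_iteratedFDeriv (m := m) (by exact_mod_cast le_top))).measurable.pow_const 2).aemeasurable
      _ ≤ ENNReal.ofReal (C ^ 2) * (((K + 1 : ℕ) : ℝ≥0∞) * ENNReal.ofReal (((n : ℝ) ^ K) ^ 2 + 1) * T) := by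
          refine mul_le_mul' le_rfl ?_
          rw [mul_assoc]
          refine mul_le_mul' (by exact_mod_cast (show i + 1 ≤ K + 1 by omega)) ?_
          rw [hT, Finset.mul_sum]
          refine (Finset.sum_le_sum_of_subset_of_nonneg (Finset.range_mono (by omega)) fun _ _ _ ↦ bot_le).trans (Finset.sum_le_sum fun m hm ↦ ?_)
          have hm' : m ≤ K := Nat.lt_succ_iff.1 (Finset.mem_range.1 hm)
          refine (lintegral_iteratedFDeriv_sq_le hg m).trans (mul_le_mul' (ENNReal.ofReal_le_ofReal ?_) le_rfl)
          rcases Nat.eq_zero_or_pos n with h0 | hpos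
          · have h1 : ((n : ℝ) ^ m) ^ 2 ≤ 1 := by
              rw [h0, Nat.cast_zero]
              exact pow_le_one₀ (by positivity) (pow_le_one₀ le_rfl zero_le_one)
            have h2 : 0 ≤ ((n : ℝ) ^ K) ^ 2 := sq_nonneg _
            linarith
          · have h1 : ((n : ℝ) ^ m) ^ 2 ≤ ((n : ℝ) ^ K) ^ 2 :=
              pow_le_pow_left₀ (by positivity) (pow_le_pow_right₀ (by exact_mod_cast hpos) hm') 2
            linarith
  -- assemble with `E_K(Φ) ≤ Σ_i n^i ∫ ‖Dⁱ Φ‖²`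
  refine (sobolevEnergy_le_sum_lintegral_iteratedFDeriv hF K).trans ?_
  calc ∑ i ∈ Finset.range (K + 1), ((n : ℝ≥0∞) ^ i) * ∫⁻ y, ‖iteratedFDeriv ℝ i Φ y‖ₑ ^ 2
      ≤ ∑ i ∈ Finset.range (K + 1), ((n : ℝ≥0∞) ^ i) * (ENNReal.ofReal (C ^ 2) * (((K + 1 : ℕ) : ℝ≥0∞) * ENNReal.ofReal (((n : ℝ) ^ K) ^ 2 + 1) * T)) :=
        Finset.sum_le_sum fun i hi ↦ mul_le_mul' le_rfl (hint i (Nat.lt_succ_iff.1 (Finset.mem_range.1 hi)))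
    _ = A * ENNReal.ofReal (C ^ 2) * T := by rw [hA, Finset.sum_mul, Finset.sum_mul]; exact Finset.sum_congr rfl fun i _ ↦ by ring

end Literature.Analysis.PDE
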